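import Summits.Ventures.CertifiedQuantumChemistry.Rows.FrozenCoreRelaxationHole
import Mathlib.Analysis.Matrix.PosDef
import HarnessLib

/-!
# Ventures/CertifiedQuantumChemistry — Rows/FrozenCoreRelaxationParticleHole.lean: `G ⪰ γγ†` on the
# DQG-feasible set, and the `G`-condition transports along the frozen-core extension

HONEST FRAMING (verbatim): certified bounds for a stated model Hamiltonian in a stated basis; not a
claim about the real molecule beyond that model.

Seat rdm-B (gen 22), file 4 of the relaxation-level frozen-core set (files 1–3:
`Rows/FrozenCoreRelaxation{Pair,Blocks,Hole}.lean`). Two results: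

1. **`gMap_sub_vecMulVec_posSemidef`** — on the ABSTRACT DQG-feasible set the particle-hole matrix
   dominates the rank-one matrix of the one-matrix read as a pair vector: `G − γγ† ⪰ 0`
   (`G^{ij}_{kl} − γ_ij γ̄_kl ⪰ 0`; for states the variance inequality `⟨A†A⟩ ≥ |⟨A⟩|²`). Proof from
   `G ⪰ 0` alone by the Cauchy–Schwarz inequality against the TRACE VECTOR `t = Σ_k e_(k,k)`: the
   contraction row and antisymmetry give `G t = N γ` (`gMap_mulVec_traceVec`), the trace row gives
   `t† γ = N`, and `γ = 0` when `N = 0` (`γ ⪰ 0`, `Tr γ = 0`, Mathlib's `PosSemidef.trace_eq_zero_iff`).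
2. **`gMap_frozen`** — the particle-hole matrix of the extended pair decomposes into five positive
   pieces, `gMap γ' Γ' = R R† + E₂ (gMap γ Γ − γγ†) E₂ᴴ + Σ_{v virtual} P_v γ P_vᴴ + Σ_{k∈K} Q_k (1 − γᵀ) Q_kᴴ + D`
   with `R = E₂ γ + Σ_{k∈K} e_(k,k)` (the active one-matrix couples to the core number operators through ONE
   rank-one term — this is where item 1 is needed), the active-particle / virtual-hole blocks `γ`
   (`P_v = activeEnv e v`), the core-particle / active-hole blocks `¹Q = 1 − γᵀ` (`Q_k = envActive e k`), and
   the diagonal `D` = identity on the core → virtual excitations; checked block by block (16 patterns, the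
   all-environment block folded into the closed form `particleHoleRDM_single` of `²G(|K⟩)`). Hence
   **`posSemidef_gMap_frozen`** and `posSemidef_gMap_frozen_of_isDQGFeasible`: on the DQG-feasible set with
   `N + 2 ≤ |ι|` THE `G`-CONDITION TRANSPORTS.

With files 1 and 3: `D`, `Q`, `G` all transport; the linear and sector rows and the energy identity
(`IsDQGFeasibleSector` transport, `pqgSectorEnergy` inequality) follow in the next files. All PROVED
(0 sorry, no definition); abstract programme objects only. References: D. A. Mazziotti, Adv. Chem. Phys.
134 (2007) ch. 3 §II.B eqs. (13), (15)–(16) [Mazziotti2007RDMChapter]; T. Helgaker, P. Jørgensen, J. Olsen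
(2000) §12.5.1 [HelgakerJorgensenOlsen2000].
-/

noncomputable section

namespace Summit.Ventures.CertifiedQuantumChemistry

open Matrix Finset
open Literature.MathematicalPhysics.QuantumLattice Literature.MathematicalPhysics.QuantumChemistry JWEmbed
open scoped ComplexOrder

variable {ι ι' : Type*} [LinearOrder ι] [LinearOrder ι'] [Fintype ι] [Fintype ι']
variable (e : ι ↪o ι') {K : Finset ι'}

/-! ## The particle-hole (`G`) matrix of the extended pair -/

section ParticleHole

variable (γ : Matrix ι ι ℂ) (Γ : Matrix (ι × ι) (ι × ι) ℂ)

/-- **The particle-hole matrix of an occupation-number vector** `|T⟩` in closed form: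
`²G(|T⟩)^{ij}_{kl} = [i = j ∈ T][k = l ∈ T] + [i = k ∈ T][j = l ∉ T]` (number–number correlations of
the occupied orbitals plus the particle-hole excitations `T ∋ i → j ∉ T`). -/
theorem particleHoleRDM_single (T : Finset ι') (i j k l : ι') :
    particleHoleRDM (Pi.single T (1 : ℂ)) (i, j) (k, l) =
      (if i = j ∧ j ∈ T then (1 : ℂ) else 0) * star (if k = l ∧ l ∈ T then (1 : ℂ) else 0) +
        if i = k ∧ j = l then (if i ∈ T ∧ j ∉ T then 1 else 0) else 0 := by
  rw [particleHoleRDM_apply, oneRDM_single, twoRDM_single]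
  by_cases hi : i ∈ T <;> by_cases hj : j ∈ T <;> by_cases hl : l ∈ T <;> by_cases h1 : i = k <;>
    by_cases h2 : j = l <;> by_cases h3 : i = j <;> by_cases h4 : k = l <;> simp_all [eq_comm]

/-- `(w (star w)ᵀ) x = (star w ⬝ x) • w`: a rank-one matrix acts by projection onto its column. -/
theorem vecMulVec_star_mulVec {n : Type*} [Fintype n] (w x : n → ℂ) :
    vecMulVec w (star w) *ᵥ x = (star w ⬝ᵥ x) • w := by
  ext p
  simp only [mulVec, dotProduct, vecMulVec_apply, Pi.smul_apply, Pi.star_apply, smul_eq_mul,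
    Finset.sum_mul]
  exact Finset.sum_congr rfl fun q _ => by ring

/-- The quadratic form of `M − w (star w)ᵀ`: `x† (M − w w†) x = x† M x − |w† x|²`. -/
theorem star_dotProduct_sub_vecMulVec_mulVec {n : Type*} [Fintype n] (M : Matrix n n ℂ) (w x : n → ℂ) :
    star x ⬝ᵥ (M - vecMulVec w (star w)) *ᵥ x =
      star x ⬝ᵥ M *ᵥ x - (star w ⬝ᵥ x) * star (star w ⬝ᵥ x) := by
  rw [sub_mulVec, dotProduct_sub, vecMulVec_star_mulVec, dotProduct_smul, smul_eq_mul,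
    ← star_dotProduct]

/-- For a Hermitian matrix, `(star a) · (M x) = star (M a) · x`. -/
theorem star_dotProduct_mulVec_of_isHermitian {n : Type*} [Fintype n] {M : Matrix n n ℂ}
    (hM : M.IsHermitian) (a x : n → ℂ) : star a ⬝ᵥ M *ᵥ x = star (M *ᵥ a) ⬝ᵥ x := by
  rw [dotProduct_mulVec, star_mulVec, hM.eq]

/-- On the DQG-feasible set the `G`-matrix applied to the TRACE VECTOR `t = Σ_k e_(k,k)` returns `N`
times the one-matrix read as a pair vector: `Σ_k G^{ij}_{kk} = γ_ij − Σ_k Γ^{ik}_{kj} = N γ_ij`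
(contraction row (16) and antisymmetry). -/
theorem gMap_mulVec_traceVec {N : ℕ} (h : IsDQGFeasible N γ Γ) :
    gMap γ Γ *ᵥ (fun p : ι × ι => if p.1 = p.2 then (1 : ℂ) else 0) =
      (N : ℂ) • fun p : ι × ι => γ p.1 p.2 := by
  ext ⟨i, j⟩
  simp only [mulVec, dotProduct, Fintype.sum_prod_type, mul_ite, mul_one, mul_zero, Finset.sum_ite_eq,
    Finset.mem_univ, if_true, gMap_apply, Pi.smul_apply, smul_eq_mul]
  have hc : ∑ k, Γ (i, k) (k, j) = -(((N : ℂ) - 1) * γ i j) := by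
    rw [← h.contract i j, ← Finset.sum_neg_distrib]
    exact Finset.sum_congr rfl fun k _ => by rw [h.swap_snd (i, k) j k]
  rw [Finset.sum_sub_distrib, hc, Finset.sum_ite_eq Finset.univ j, if_pos (Finset.mem_univ _)]
  ring

/-- `t† γ = Tr γ = N` for the trace vector `t` and the one-matrix read as a pair vector. -/
theorem traceVec_dotProduct_one {N : ℕ} (h : IsDQGFeasible N γ Γ) :
    star (fun p : ι × ι => if p.1 = p.2 then (1 : ℂ) else 0) ⬝ᵥ (fun p : ι × ι => γ p.1 p.2) = N := by
  simp only [dotProduct, Fintype.sum_prod_type, Pi.star_apply, apply_ite star, star_one, star_zero,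
    ite_mul, one_mul, zero_mul, Finset.sum_ite_eq, Finset.mem_univ, if_true, h.trace_one]

/-- **`G ⪰ γγ†` ON THE DQG-FEASIBLE SET**: the particle-hole matrix dominates the rank-one matrix of
the one-matrix read as a pair vector, `G^{ij}_{kl} − γ_ij γ̄_kl ⪰ 0`. For states this is the variance
inequality `⟨A†A⟩ ≥ |⟨A⟩|²` (`A = Σ x̄_ij a†_j a_i`); for an ABSTRACT feasible pair it follows from
`G ⪰ 0` by the Cauchy–Schwarz inequality against the trace vector `t` (`G t = N γ`, `t† γ = N`:
contraction row, antisymmetry, trace row), with `γ = 0` when `N = 0` (`γ ⪰ 0`, `Tr γ = 0`). This is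
what lets the number–number block of a frozen core couple consistently to the active `G`-matrix. -/
theorem gMap_sub_vecMulVec_posSemidef {N : ℕ} (h : IsDQGFeasible N γ Γ) :
    (gMap γ Γ - vecMulVec (fun p : ι × ι => γ p.1 p.2) (star fun p : ι × ι => γ p.1 p.2)).PosSemidef := by
  set v : ι × ι → ℂ := fun p => γ p.1 p.2 with hv
  set t : ι × ι → ℂ := fun p => if p.1 = p.2 then (1 : ℂ) else 0 with ht
  have hG := h.g_psd
  refine PosSemidef.of_dotProduct_mulVec_nonneg (hG.1.sub (posSemidef_vecMulVec_self_star v).1)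
    fun x => ?_
  rw [star_dotProduct_sub_vecMulVec_mulVec]
  set c : ℂ := star v ⬝ᵥ x with hc
  rcases Nat.eq_zero_or_pos N with hN | hN
  · -- `N = 0`: the one-matrix vanishes, so the rank-one correction is zero
    have hγ0 : γ = 0 := by
      have htr : γ.trace = 0 := by
        rw [Matrix.trace]; simp only [diag_apply, h.trace_one, hN, Nat.cast_zero]
      exact h.one_posSemidef.trace_eq_zero_iff.1 htr
    have hc0 : c = 0 := by
      rw [hc, hv]
      simp only [hγ0, Matrix.zero_apply, dotProduct, Pi.star_apply, star_zero, zero_mul,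
        Finset.sum_const_zero]
    rw [hc0, zero_mul, sub_zero]
    exact hG.dotProduct_mulVec_nonneg x
  · -- `N ≥ 1`: Cauchy–Schwarz with the trace vector, `z = N x − c t`
    have hGt : gMap γ Γ *ᵥ t = (N : ℂ) • v := gMap_mulVec_traceVec γ Γ h
    have htv : star t ⬝ᵥ v = N := traceVec_dotProduct_one γ Γ h
    have htGx : star t ⬝ᵥ gMap γ Γ *ᵥ x = (N : ℂ) * c := by
      rw [star_dotProduct_mulVec_of_isHermitian hG.1, hGt, star_smul, star_natCast, smul_dotProduct,
        smul_eq_mul]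
    have hxGt : star x ⬝ᵥ gMap γ Γ *ᵥ t = (N : ℂ) * star c := by
      rw [hGt, dotProduct_smul, smul_eq_mul, hc, ← star_dotProduct]
    have htGt : star t ⬝ᵥ gMap γ Γ *ᵥ t = (N : ℂ) * N := by
      rw [hGt, dotProduct_smul, smul_eq_mul, htv]
    have hz := hG.dotProduct_mulVec_nonneg ((N : ℂ) • x - c • t)
    have hexp : star ((N : ℂ) • x - c • t) ⬝ᵥ gMap γ Γ *ᵥ ((N : ℂ) • x - c • t) =
        (N : ℂ) ^ 2 * (star x ⬝ᵥ gMap γ Γ *ᵥ x - c * star c) := by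
      simp only [mulVec_sub, mulVec_smul, star_sub, star_smul, sub_dotProduct, dotProduct_sub,
        smul_dotProduct, dotProduct_smul, smul_eq_mul, star_natCast, htGx, hxGt, htGt]
      ring
    rw [hexp] at hz
    have hN2 : (0 : ℝ) < (N : ℝ) ^ 2 := by positivity
    have hinv : (0 : ℂ) ≤ ((N : ℂ) ^ 2)⁻¹ := by
      have : ((N : ℂ) ^ 2)⁻¹ = (((N : ℝ) ^ 2)⁻¹ : ℝ) := by push_cast; ring
      rw [this]
      exact Complex.zero_le_real.2 (inv_nonneg.2 hN2.le)
    have hne : ((N : ℂ) ^ 2) ≠ 0 := by exact_mod_cast hN2.ne'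
    have : star x ⬝ᵥ gMap γ Γ *ᵥ x - c * star c =
        ((N : ℂ) ^ 2)⁻¹ * ((N : ℂ) ^ 2 * (star x ⬝ᵥ gMap γ Γ *ᵥ x - c * star c)) := by
      rw [← mul_assoc, inv_mul_cancel₀ hne, one_mul]
    rw [this]
    exact mul_nonneg hinv hz

/-- **THE `G`-MATRIX OF THE EXTENDED PAIR** decomposes into five positive pieces:
`gMap γ' Γ' = R R† + E₂ (gMap γ Γ − γγ†) E₂ᴴ + Σ_{v virtual} P_v γ P_vᴴ + Σ_{k ∈ K} Q_k (1 − γᵀ) Q_kᴴ + D`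
with the pair vector `R = E₂ γ + Σ_{k ∈ K} e_(k,k)` (the active one-matrix and the core number
operators couple through a rank-one term), the active particle / virtual hole blocks `γ`, the core
particle / active hole blocks `¹Q = 1 − γᵀ`, and the diagonal `D` = identity on the core → virtual
excitations. An identity of affine maps in `(γ, Γ)` for Hermitian `γ`, checked block by block. -/
theorem gMap_frozen (hK : Disjoint K (rangeF e)) (hγ : γ.IsHermitian) :
    gMap (frozenOne e K γ) (frozenTwo e K γ Γ) =
      vecMulVec (embTwo e *ᵥ (fun r : ι × ι => γ r.1 r.2) +
            fun p : ι' × ι' => if p.1 = p.2 ∧ p.2 ∈ K then (1 : ℂ) else 0)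
          (star (embTwo e *ᵥ (fun r : ι × ι => γ r.1 r.2) +
            fun p : ι' × ι' => if p.1 = p.2 ∧ p.2 ∈ K then (1 : ℂ) else 0)) +
        embTwo e * (gMap γ Γ - vecMulVec (fun r : ι × ι => γ r.1 r.2) (star fun r : ι × ι => γ r.1 r.2)) *
          (embTwo e)ᴴ +
        ∑ v ∈ (rangeF e ∪ K)ᶜ, activeEnv e v * γ * (activeEnv e v)ᴴ +
        ∑ k ∈ K, envActive e k * (1 - γᵀ) * (envActive e k)ᴴ +
        Matrix.diagonal (fun p : ι' × ι' => if p.1 ∈ K ∧ p.2 ∈ (rangeF e ∪ K)ᶜ then (1 : ℂ) else 0) := by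
  have hV := disjoint_compl_union_rangeF e K
  ext ⟨p₁, p₂⟩ ⟨q₁, q₂⟩
  simp only [Matrix.add_apply, vecMulVec_apply, Pi.add_apply, Pi.star_apply, star_add,
    Matrix.diagonal_apply, Prod.mk.injEq]
  rcases rangeF_cases e p₁ with ⟨i₁, rfl⟩ | hp₁ <;> rcases rangeF_cases e p₂ with ⟨i₂, rfl⟩ | hp₂ <;>
    rcases rangeF_cases e q₁ with ⟨j₁, rfl⟩ | hq₁ <;> rcases rangeF_cases e q₂ with ⟨j₂, rfl⟩ | hq₂
  · -- I I I I: `G = γγ† + (G − γγ†)`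
    simp only [gMap_apply, frozenOne_apply_apply e γ hK, frozenTwo_active e γ Γ hK,
      embTwo_mulVec_active, embTwo_mul_mul_active, sum_activeEnv_mul_mul_active_col e _ _ hV,
      sum_envActive_mul_mul_active_row e _ _ hK, Matrix.sub_apply, vecMulVec_apply, Pi.star_apply,
      OrderEmbedding.eq_iff_eq, apply_mem_iff e hK, and_false, false_and, if_false, add_zero, star_zero,
      ite_self]
    ring
  · -- I I I E
    simp only [gMap_apply, frozenTwo_IEII e γ Γ hK _ _ _ hq₂, embTwo_mulVec_env_snd e _ hq₂,
      embTwo_mul_mul_env_snd' e _ hq₂, sum_activeEnv_mul_mul_active_row e _ _ hV,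
      sum_envActive_mul_mul_active_row e _ _ hK, apply_eq_env_iff e hq₂, false_and, and_false, if_false,
      star_zero, add_zero, mul_zero, sub_self]
  · -- I I E I
    simp only [gMap_apply, frozenOne_apply_env e γ hq₁, frozenTwo_IIEI e γ Γ hK _ _ _ hq₁,
      embTwo_mulVec_env_fst e _ hq₁, embTwo_mul_mul_env_fst' e _ hq₁,
      sum_activeEnv_mul_mul_active_row e _ _ hV, sum_envActive_mul_mul_active_row e _ _ hK,
      env_eq_apply_iff e hq₁, apply_eq_env_iff e hq₁, false_and, if_false, ite_self, star_zero, add_zero,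
      mul_zero, sub_self]
  · -- I I E E: the active one-matrix couples to the core number operators
    simp only [gMap_apply, frozenTwo_IEEI e γ Γ hK _ _ hq₂, embTwo_mulVec_active, embTwo_mulVec_env_fst e _ hq₁,
      embTwo_mul_mul_env_fst' e _ hq₁, sum_activeEnv_mul_mul_active_row e _ _ hV,
      sum_envActive_mul_mul_active_row e _ _ hK, OrderEmbedding.eq_iff_eq, apply_mem_iff e hK,
      apply_eq_env_iff e hq₂, apply_eq_env_iff e hq₁, false_and, and_false, if_false, zero_add, add_zero,
      zero_sub, apply_ite star, star_one, star_zero]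
    by_cases h₁ : q₁ = q₂ <;> by_cases h₂ : q₁ ∈ K <;> by_cases h₃ : q₂ ∈ K <;> simp_all [eq_comm]
  · -- I E I I
    simp only [gMap_apply, frozenTwo_IIIE e γ Γ hK _ _ _ hp₂, embTwo_mulVec_env_snd e _ hp₂,
      embTwo_mul_mul_env_snd e _ hp₂, sum_activeEnv_mul_mul_active_col e _ _ hV,
      sum_envActive_mul_mul_active_row e _ _ hK, env_eq_apply_iff e hp₂, apply_eq_env_iff e hp₂,
      false_and, and_false, if_false, zero_mul, add_zero, sub_self]
  · -- I E I E: active particle, virtual hole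
    simp only [gMap_apply, frozenOne_apply_apply e γ hK, frozenTwo_IEIE e γ Γ hK _ _ hq₂,
      embTwo_mulVec_env_snd e _ hp₂, embTwo_mul_mul_env_snd e _ hp₂, sum_activeEnv_mul_mul_IEIE,
      sum_envActive_mul_mul_active_row e _ _ hK, env_mem_compl_union_iff e K hq₂,
      apply_eq_env_iff e hp₂, apply_mem_iff e hK, false_and, if_false, zero_add, zero_mul, add_zero,
      ite_self]
    by_cases h₁ : p₂ = q₂ <;> by_cases h₂ : p₂ ∈ K <;> by_cases h₃ : q₂ ∈ K <;> simp_all [eq_comm]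
  · -- I E E I
    simp only [gMap_apply, frozenTwo_IIEE e γ Γ hK _ _ hq₁ hp₂, embTwo_mulVec_env_snd e _ hp₂,
      embTwo_mul_mul_env_snd e _ hp₂, sum_activeEnv_mul_mul_env_col e _ _ hq₁,
      sum_envActive_mul_mul_active_row e _ _ hK, env_eq_apply_iff e hp₂, apply_eq_env_iff e hp₂,
      apply_eq_env_iff e hq₁, false_and, if_false, zero_mul, add_zero, sub_self]
  · -- I E E E
    simp only [gMap_apply, frozenOne_apply_env e γ hq₁, frozenTwo_IEEE e γ Γ _ hq₁ hq₂ hp₂,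
      embTwo_mulVec_env_snd e _ hp₂, embTwo_mul_mul_env_snd e _ hp₂, sum_activeEnv_mul_mul_env_col e _ _ hq₁,
      sum_envActive_mul_mul_active_row e _ _ hK, apply_eq_env_iff e hp₂, apply_eq_env_iff e hq₁,
      false_and, if_false, ite_self, zero_mul, add_zero, sub_self]
  · -- E I I I
    simp only [gMap_apply, frozenOne_env_apply e γ hp₁, frozenTwo_EIII e γ Γ hK _ _ _ hp₁,
      embTwo_mulVec_env_fst e _ hp₁, embTwo_mul_mul_env_fst e _ hp₁, sum_activeEnv_mul_mul_env_row e _ _ hp₁,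
      sum_envActive_mul_mul_active_col e _ _ hK, env_eq_apply_iff e hp₁, apply_mem_iff e hK, and_false,
      false_and, if_false, ite_self, zero_mul, add_zero, sub_self]
  · -- E I I E
    simp only [gMap_apply, frozenTwo_EEII e γ Γ hK _ _ hp₁ hq₂, embTwo_mulVec_env_fst e _ hp₁,
      embTwo_mul_mul_env_fst e _ hp₁, sum_activeEnv_mul_mul_env_row e _ _ hp₁,
      sum_envActive_mul_mul_active_col e _ _ hK, env_eq_apply_iff e hp₁, apply_eq_env_iff e hq₂,
      apply_mem_iff e hK, and_false, false_and, if_false, zero_mul, add_zero, sub_self]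
  · -- E I E I: core particle, active hole (`¹Q = 1 − γᵀ`)
    simp only [gMap_apply, frozenOne_env_env e γ hp₁, frozenTwo_EIEI e γ Γ hK _ _ hp₁,
      embTwo_mulVec_env_fst e _ hp₁, embTwo_mul_mul_env_fst e _ hp₁, sum_activeEnv_mul_mul_env_row e _ _ hp₁,
      sum_envActive_mul_mul_EIEI, OrderEmbedding.eq_iff_eq, apply_mem_iff e hK, apply_mem_iff e hV,
      and_false, if_false, zero_add, zero_mul, add_zero, ite_self, Matrix.sub_apply,
      Matrix.one_apply, Matrix.transpose_apply]
    by_cases h₁ : i₂ = j₂ <;> by_cases h₂ : p₁ = q₁ <;> by_cases h₃ : q₁ ∈ K <;> simp_all [eq_comm]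
  · -- E I E E
    simp only [gMap_apply, frozenTwo_EEEI e γ Γ hK _ hp₁ hq₂, embTwo_mulVec_env_fst e _ hp₁,
      embTwo_mul_mul_env_fst e _ hp₁, sum_activeEnv_mul_mul_env_row e _ _ hp₁,
      sum_envActive_mul_mul_env_col e _ _ _ _ hq₂, apply_eq_env_iff e hq₂, apply_mem_iff e hK, and_false,
      if_false, zero_mul, add_zero, sub_self]
  · -- E E I I: the core number operators couple to the active one-matrix (Hermiticity of `γ`)
    simp only [gMap_apply, frozenTwo_EIIE e γ Γ hK _ _ hp₁, embTwo_mulVec_active, embTwo_mulVec_env_fst e _ hp₁,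
      embTwo_mul_mul_env_fst e _ hp₁, sum_activeEnv_mul_mul_env_row e _ _ hp₁,
      sum_envActive_mul_mul_active_col e _ _ hK, OrderEmbedding.eq_iff_eq, apply_mem_iff e hK,
      env_eq_apply_iff e hp₂, env_eq_apply_iff e hp₁, and_false, if_false, zero_add, add_zero,
      zero_sub, star_zero, hγ.apply]
    by_cases h₁ : p₁ = p₂ <;> by_cases h₂ : p₂ ∈ K <;> simp_all [eq_comm]
  · -- E E I E
    simp only [gMap_apply, frozenOne_env_apply e γ hp₁, frozenTwo_EEIE e γ Γ hK _ hp₁ hq₂,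
      embTwo_mulVec_env_snd e _ hq₂, embTwo_mul_mul_env_fst e _ hp₁, sum_activeEnv_mul_mul_env_row e _ _ hp₁,
      sum_envActive_mul_mul_active_col e _ _ hK, env_eq_apply_iff e hp₁, apply_eq_env_iff e hq₂,
      false_and, if_false, ite_self, star_zero, add_zero, mul_zero, sub_self]
  · -- E E E I
    simp only [gMap_apply, frozenTwo_EIEE e γ Γ _ hp₁ hq₁ hp₂, embTwo_mulVec_env_fst e _ hq₁,
      embTwo_mul_mul_env_fst e _ hp₁, sum_activeEnv_mul_mul_env_row e _ _ hp₁,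
      sum_envActive_mul_mul_env_row e _ _ _ hp₂, env_eq_apply_iff e hp₂, env_eq_apply_iff e hq₁,
      apply_mem_iff e hK, and_false, if_false, star_zero, add_zero, mul_zero, sub_self]
  · -- E E E E: the particle-hole matrix of `|K⟩` on environment indices
    rw [gMap_apply, frozenOne_env_env e γ hp₁, frozenTwo_env e γ Γ hp₁ hq₂, ← oneRDM_single,
      ← twoRDM_single, ← particleHoleRDM_apply, particleHoleRDM_single]
    simp only [embTwo_mulVec_env_fst e _ hp₁, embTwo_mulVec_env_fst e _ hq₁, embTwo_mul_mul_env_fst e _ hp₁,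
      sum_activeEnv_mul_mul_env_row e _ _ hp₁, sum_envActive_mul_mul_env_row e _ _ _ hp₂,
      env_mem_compl_union_iff e K hp₂, zero_add, add_zero, star_zero]

/-- **THE `G`-CONDITION TRANSPORTS ALONG THE FROZEN-CORE EXTENSION**: if `γ` is Hermitian with
`γ ⪰ 0`, `1 − γᵀ ⪰ 0` and `gMap γ Γ − γγ† ⪰ 0`, then `gMap γ' Γ' ⪰ 0` (five positive pieces). -/
theorem posSemidef_gMap_frozen (hK : Disjoint K (rangeF e)) (hγ : γ.IsHermitian)
    (hG : (gMap γ Γ - vecMulVec (fun r : ι × ι => γ r.1 r.2) (star fun r : ι × ι => γ r.1 r.2)).PosSemidef)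
    (h0 : γ.PosSemidef) (h1 : (1 - γᵀ).PosSemidef) :
    (gMap (frozenOne e K γ) (frozenTwo e K γ Γ)).PosSemidef := by
  rw [gMap_frozen e γ Γ hK hγ]
  refine ((((posSemidef_vecMulVec_self_star _).add (hG.mul_mul_conjTranspose_same _)).add
    (posSemidef_sum _ fun v _ => h0.mul_mul_conjTranspose_same _)).add
    (posSemidef_sum _ fun k _ => h1.mul_mul_conjTranspose_same _)).add (PosSemidef.diagonal fun p => ?_)
  dsimp only [Pi.zero_apply]
  split_ifs
  · exact zero_le_one
  · exact le_rfl

/-- The `G`-condition of the extension of a DQG-feasible pair with at least two empty active spin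
orbitals (`N + 2 ≤ |ι|`). -/
theorem posSemidef_gMap_frozen_of_isDQGFeasible (hK : Disjoint K (rangeF e)) {N : ℕ}
    (h : IsDQGFeasible N γ Γ) (hr : N + 2 ≤ Fintype.card ι) :
    (gMap (frozenOne e K γ) (frozenTwo e K γ Γ)).PosSemidef :=
  posSemidef_gMap_frozen e γ Γ hK h.herm_one (gMap_sub_vecMulVec_posSemidef γ Γ h) h.one_posSemidef
    (h.oneHole_posSemidef hr)

end ParticleHole

end Summit.Ventures.CertifiedQuantumChemistry

end
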